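import Summits.HodgeConjecture.HodgeConjecture.Cruxes.BlochSeedDiscOne.SeedCheckerHighTwist
import Summits.HodgeConjecture.HodgeConjecture.Cruxes.BlochSeedDiscOne.SeedCheckerSmooth
import Summits.HodgeConjecture.HodgeConjecture.Cruxes.BlochSeedDiscOne.SeedCheckerBlochAdjugate
import Summits.HodgeConjecture.HodgeConjecture.Cruxes.BlochSeedDiscOne.SeedCheckerTwistRay
import HarnessLib

/-!
# Seed checker v28 (c5c8-1 g27): TWIST TRANSPORT — v22's abstract C7 dictionary `hdict` DERIVED from v21's law and the
# (L5⁺)(3) staircase typed as DATA, so that C7 at the lci door is ONE rank computation on (design json, presentation), end to end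

line stmt-HodgeConjecture-18881 Cruxes/BlochSeedDiscOne/Lines/birth.lean 814a6a70c14e831a stub_rung_pad4_seedAt

Cell `pub-hsemireg`, explicit unit `hsemireg-c5c8-1` (MINT A5: «type C5–C8 — (σ), (A1) at the seed, pad4-tower compatibility,
disc-one — each as a predicate on (design json, presentation) so a seed checker exists before a candidate does; flag what is vacuous
or implied by C0–C4»), generation g27. **HONEST STATUS FIRST: nothing in this file is proved toward HC ∕ HC_CM ∕ HC_AV ∕ №4 ∕ 26512 ∕
18881 ∕ H2. It is a typed file + evidence, NOT a rung: `stub_rung_pad4_seedAt` stays open, and the crux `BlochSeedDiscOne` is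
reached below only through hypothesis-carrying doors whose hypotheses (named laws + data) no one has discharged.**

## The open typing item it addresses (g26 index memo `SEED-CHECKER-C5C8-c5c8-1-g26.md` §9 (i))

v21 (`SeedCheckerBlochAdjugate`, BUILT) typed C7 at the lci door as «the adjugate Atiyah trace `blochAdjugate C ρ hF :
Ext²(𝓕,𝓕) →+ H⁸(S⁴)` is injective» modulo the named law `BlochAdjugateLaw` ((L5⁺)(1)+(2)), proved that for a REALISED design it is
the Bloch pencil of the four cupped sigmas with the design's Chern numbers as coefficients, and computed those numbers for the twisted
design `D(t)` (`Design.chernCoeff_tw`). v22 (`SeedCheckerTwistRay`, BUILT) proved the pure algebra of a cubic ray of linear maps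
`Π_t` between FIXED finite-dimensional spaces (ONE injective parameter ⟹ all but `≤ 3·dim V` parameters; the `t`-free clause
`TwistRay.LciDoorGeneric`), but consumed the geometry only through an ABSTRACT dictionary `hdict : ∀ t ≥ t₀, (C7At t ↔ Injective Π_t)`,
flagged there as «an input, not a theorem». The gap: v21's map lives on `Ext²(𝓔(tΘ), 𝓔(tΘ))`, a carrier that CHANGES with `t` and is
only an additive group in the tree, while v22's ray needs ONE `ℂ`-space `V` and `t`-independent coefficient maps. What identifies them
is the OBJECT half of (L5⁺)(3): `Ext²(𝓔(tΘ), 𝓔(tΘ)) ≅ Ext²(𝓔, 𝓔)` (twisting by a line bundle) and `At(𝓔(tΘ)) = At(𝓔) − t·h`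
(Atiyah class of a tensor product), whence the binomial STAIRCASE `σ̃_j^{𝓔(tΘ)} = Σ_{i ≤ j} C(j,i)·(−t h)^{j−i} ∪ σ̃_i^{𝓔}` — which the
tree cannot state as a theorem (no Atiyah class of a tensor product, no `ℂ`-structure or twist-invariance on `Ext`).
[cite: Huybrechts2005, Prop. 4.3.7 (ii) and Prop. 4.3.10] [cite: BuchweitzFlenner2003, Prop. 8.2 and Lemma 8.4]

## What this file types and proves (namespace `…SeedChecker`, sub-namespace `TwistTransport` for the transport data)

* §28.0 **C7 at ONE twist** `SemiregularZeroLociAt 𝓔 Θ t` (v17's C7∞ is literally `∃ t₀, ∀ t ≥ t₀, …At t`), the clause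
  `EventuallyKoszul 𝓔 Θ` (v21's Koszul window at all large twists), the optional NAMED LAW (L-Serre) `HighTwistKoszul` discharging it
  (Serre vanishing + duality on an abelian variety of dimension `≥ 6`; NEITHER PROVED NOR ASSERTED), the json-side Bloch ray
  `Design.blochRay D f t := polyFamily 3 (blochCoeff f γ₁(D) γ₂(D) γ₃(D)) t` of the UNTWISTED design, and the `t`-free clause
  `Design.LciGeneric D f := LciDoorGeneric f γ(D)`. [cite: Hartshorne1977, III Thm. 5.2 and III Cor. 7.7]
* §28.1 **the staircase as DATA**: `TwistTransport.Staircase ρ 𝓔 Θ h V W` = transport isomorphisms `e t : Ext²(𝓔(tΘ),𝓔(tΘ)) ≃+ V`,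
  an injection `ι : W ↪ H⁸`, four maps `f : Fin 4 → (V →ₗ[ℂ] W)` (the UNTWISTED cupped sigmas) and the four staircase rows — a
  structure constructed by no one here (like v21's `HodgeToBetti`, v4's `AnchorKit`). PROVED: for a design passing C0 and realised
  at every twist, **`blochAdjugate C ρ hF ∘ (e t)⁻¹ = ι ∘ D.blochRay f t`** (`Staircase.blochAdjugate_symm_apply`: json half = v21
  `Design.chernCoeff_tw`, object half = the rows, recombination = `module`), hence `Injective (blochAdjugate) ↔ Injective (D.blochRay
  f t)` (`Staircase.injective_blochAdjugate_iff`), v22's `hdict` AS A THEOREM under the law at every twist of the window carrying an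
  admissible section (`Staircase.hdict`), and the eventual form: `D.LciGeneric f` (ONE injective parameter) + `EventuallyKoszul` ⟹
  v17's C7∞ `EventuallySemiregularZeroLoci 𝓔 Θ` under `BlochAdjugateLaw` (`Staircase.eventuallySemiregularZeroLoci_of_lciGeneric`),
  plus the death form on natural twists (`Design.blochRay_dead_of_nat_failures`, v22's `3·dim V` budget).
* §28.2 **the one-rank checker and its doors**: `Design.OneRankCheck D C K 𝓔 Θ S` := C0 ∧ `Θ` ample ∧ rank `4` ∧ realised at every
  twist ∧ `EventuallyKoszul` ∧ `D.LciGeneric S.f` — ⟹ v17 `Design.HighTwistCheck` (given `BlochAdjugateLaw`) ⟹ `D.SeedCheck K i q`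
  at some twist ⟹ the conclusion of `stub_rung_pad4_seedAt` ON THAT ANCHOR ⟹ (such data on every CM anchor) the crux
  `BlochSeedDiscOne` BY NAME (`blochSeedDiscOne_of_oneRankChecks`; laws (L-conn), (L-Bert), `TopChernFourLocalisation`,
  `BlochAdjugateLaw`; (L-int) is v18's THEOREM `smoothConnectedIntegral_holds`). In coordinates `V = ℂ^m`, `W = ℂ^n` the last clause
  is `m ≤ rank` of ONE explicit matrix (v22 `TwistRay.injective_polyFamily_iff_le_rank`): «C7 = one rank computation».
* FLAGS as theorems: the `→` half of the dictionary is VACUOUS at a twist with no admissible section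
  (`semiregularZeroLociAt_of_no_admissible`); C7 remains NOT implied by C0–C4 or by the sheaf screen (v22
  `TwistRay.jointly_injective_not_suffices` stands); the staircase rows at `t = 0` pin `f` (`Staircase.ι_f_eq`), so the only freedom
  in the data is the choice of transport — which injectivity does not see.

Imports only BUILT modules (v17 `SeedCheckerHighTwist`, v18 `SeedCheckerSmooth`, v21, v22; farm build 2026-08-30T10:27Z). v23 ∕ v24 ∕
v26 ∕ v27 are still unbuilt, so g26 §9 (ii) (their joint one-liners) stays open — unchanged by this file. No `sorry`, no `axiom`, no
`instance`, no `notation`, no `macro`, no unsafe reducibility option.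
-/

noncomputable section

set_option linter.dupNamespace false

open CategoryTheory CategoryTheory.Abelian AlgebraicGeometry
open Literature.AlgebraicGeometry Literature.AlgebraicGeometry.Modules Literature.AlgebraicGeometry.Motives
open Literature.AlgebraicGeometry.HodgeTheory
open Literature.AlgebraicTopology.SingularHomology

namespace Summit.HodgeConjecture.HodgeConjecture.Cruxes.BlochSeedDiscOne.SeedChecker

open Summit.HodgeConjecture.HodgeConjecture.Cruxes.BlochSeedDiscOne.Anchor
open Summit.Ventures.HSemireg Summit.Ventures.HSemireg.Pad4Tower

section VTwentyEight

/-! ### §28.0 C7 at one twist, the Koszul clause, the law (L-Serre), and the json-side Bloch ray of the untwisted design -/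

section OneTwist

variable {X : Motives.SchemeOver ℂ} [AlgebraicGeometry.IsIntegral X.left]

/-- **C7 AT THE TWIST `t`**: every regular codimension-`4` zero scheme `Z(s)`, `s ∈ H⁰(X, 𝓔(tΘ))`, is Bloch-semiregular in
`(X, n = 8, p = 4)`. v17's C7∞ `EventuallySemiregularZeroLoci 𝓔 Θ` is `∃ t₀, ∀ t ≥ t₀, SemiregularZeroLociAt 𝓔 Θ t`
(`eventuallySemiregularZeroLoci_iff`, `Iff.rfl`). A DEFINITION on the tree's real carriers. -/
def SemiregularZeroLociAt (𝓔 : X.left.Modules) (Θ : CartierDivisor X.left) (t : ℕ) : Prop :=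
  ∀ (s : Modules.unitModule X.left ⟶ twistBy 𝓔 Θ t) ⦃Z : Scheme.{0}⦄ (i : Z ⟶ X.left),
    IsZeroSchemeOf s i → IsRegularImmersionOfCodim i 4 → IsBlochSemiregular i (2 * 4) 4

/-- **THE KOSZUL CLAUSE, EVENTUALLY**: `𝓔(tΘ)` lies in v21's Koszul window (`KoszulWindowAcyclic`) for every `t ≥ t₀`. For `Θ` ample
and `𝓔` locally free on an abelian `8`-fold this is Serre vanishing + duality (the law `HighTwistKoszul` below); as a clause of the
checker it is a predicate on the presentation. -/
def EventuallyKoszul (𝓔 : X.left.Modules) (Θ : CartierDivisor X.left) : Prop :=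
  ∃ t₀ : ℕ, ∀ t : ℕ, t₀ ≤ t → KoszulWindowAcyclic (twistBy 𝓔 Θ t)

/-- rank `r` ⟹ `𝓔(tΘ)` is finite locally free (the `hF` v21's `blochAdjugate` is indexed by). -/
theorem isFiniteLocallyFree_twistBy {𝓔 : X.left.Modules} {r : ℕ} (hrk : HasRank 𝓔 r) (Θ : CartierDivisor X.left) (t : ℕ) :
    IsFiniteLocallyFree (twistBy 𝓔 Θ t) :=
  HasRank.isFiniteLocallyFree' (hasRank_twistBy hrk Θ t)

variable {C : ChernCharacterBetti} {ρ : HodgeToBetti X} {𝓔 : X.left.Modules} {Θ : CartierDivisor X.left}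

/-- how v21's law is consumed AT ONE TWIST: injective adjugate trace of `𝓔(tΘ)` (in the window) ⟹ C7 at `t`. -/
theorem semiregularZeroLociAt_of_injective (hlaw : BlochAdjugateLaw C X ρ) (hrk : HasRank 𝓔 4) {t : ℕ}
    (hK : KoszulWindowAcyclic (twistBy 𝓔 Θ t))
    (hinj : Function.Injective (blochAdjugate C ρ (isFiniteLocallyFree_twistBy hrk Θ t))) :
    SemiregularZeroLociAt 𝓔 Θ t :=
  fun s _Z _i hZ hreg => isBlochSemiregular_of_blochAdjugateLaw _ hlaw (hasRank_twistBy hrk Θ t) hK s hZ hreg hinj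

/-- … and conversely, C7 at `t` read on ONE admissible section (regular codimension-`4` zero scheme) certifies the trace injective. -/
theorem injective_of_semiregularZeroLociAt (hlaw : BlochAdjugateLaw C X ρ) (hrk : HasRank 𝓔 4) {t : ℕ}
    (hK : KoszulWindowAcyclic (twistBy 𝓔 Θ t)) {s : Modules.unitModule X.left ⟶ twistBy 𝓔 Θ t} {Z : Scheme.{0}}
    {i : Z ⟶ X.left} (hZ : IsZeroSchemeOf s i) (hreg : IsRegularImmersionOfCodim i 4) (h : SemiregularZeroLociAt 𝓔 Θ t) :
    Function.Injective (blochAdjugate C ρ (isFiniteLocallyFree_twistBy hrk Θ t)) :=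
  blochAdjugate_injective_of_isBlochSemiregular _ hlaw (hasRank_twistBy hrk Θ t) hK s hZ hreg (h s i hZ hreg)

/-- the object-level dictionary AT ONE TWIST, given the law and ONE admissible section: C7 at `t` ⟺ injective adjugate trace. -/
theorem semiregularZeroLociAt_iff_injective (hlaw : BlochAdjugateLaw C X ρ) (hrk : HasRank 𝓔 4) {t : ℕ}
    (hK : KoszulWindowAcyclic (twistBy 𝓔 Θ t))
    (hex : ∃ (s : Modules.unitModule X.left ⟶ twistBy 𝓔 Θ t) (Z : Scheme.{0}) (i : Z ⟶ X.left),
      IsZeroSchemeOf s i ∧ IsRegularImmersionOfCodim i 4) :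
    SemiregularZeroLociAt 𝓔 Θ t ↔ Function.Injective (blochAdjugate C ρ (isFiniteLocallyFree_twistBy hrk Θ t)) := by
  obtain ⟨s, Z, i, hZ, hreg⟩ := hex
  exact ⟨injective_of_semiregularZeroLociAt hlaw hrk hK hZ hreg, semiregularZeroLociAt_of_injective hlaw hrk hK⟩

/-- **FLAG (the `→` half of the dictionary is VACUOUS without a section)**: at a twist where NO section has a regular codimension-`4`
zero scheme, C7 at `t` holds trivially — so «C7 at `t` ⟹ injective» needs the existential of `semiregularZeroLociAt_iff_injective`
((L-Bert) supplies it at high twist); the `←` half needs nothing. -/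
theorem semiregularZeroLociAt_of_no_admissible {t : ℕ}
    (hno : ∀ (s : Modules.unitModule X.left ⟶ twistBy 𝓔 Θ t) ⦃Z : Scheme.{0}⦄ (i : Z ⟶ X.left),
      IsZeroSchemeOf s i → ¬ IsRegularImmersionOfCodim i 4) :
    SemiregularZeroLociAt 𝓔 Θ t :=
  fun s _Z i hZ hreg => (hno s i hZ hreg).elim

end OneTwist

/-- v17's C7∞ on the anchor IS «C7 at every sufficiently large twist» (definitional). -/
theorem eventuallySemiregularZeroLoci_iff {E₀ : AbelianVariety ℂ} [AlgebraicGeometry.IsIntegral (pad4Anchor E₀).X.left]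
    (𝓔 : (pad4Anchor E₀).X.left.Modules) (Θ : CartierDivisor (pad4Anchor E₀).X.left) :
    EventuallySemiregularZeroLoci 𝓔 Θ ↔ ∃ t₀ : ℕ, ∀ t : ℕ, t₀ ≤ t → SemiregularZeroLociAt 𝓔 Θ t :=
  Iff.rfl

/-- **LAW (L-Serre) — THE KOSZUL WINDOW OPENS AT HIGH TWIST, A NAMED STATEMENT, NEITHER PROVED NOR ASSERTED HERE** (consumed as
`(hser : HighTwistKoszul)`): on a complex abelian variety `A` of dimension `≥ 6` with an ample Cartier divisor `Θ`, a rank-`4` vector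
bundle `𝓔` has `𝓔(tΘ)` in v21's Koszul window for all `t ≫ 0`. Mathematics: `H^q(𝓔(tΘ)) = 0` for `q = 1, 2` and `t ≫ 0` is Serre
vanishing; `𝓔(tΘ) ⊗ ((𝓔(tΘ))^∨)^{⊗j} ≅ (𝓔 ⊗ (𝓔^∨)^{⊗j})((1−j)tΘ)` has a NEGATIVE twist for `j ≥ 2`, so `H^q = 0` for `q ≤ j+1 ≤ 5 <
dim A` by Serre duality (`ω_A ≅ 𝒪_A`, locally free coefficients) and Serre vanishing. Not in the tree (no Serre vanishing ∕ duality
for the glued line bundle `Modules.lineBundle`), hence a NAMED LAW; it discharges the clause `EventuallyKoszul` of the checker below and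
is OPTIONAL (the doors take the clause, not the law). [cite: Hartshorne1977, III Thm. 5.2 and III Cor. 7.7] -/
def HighTwistKoszul : Prop :=
  ∀ (A : AbelianVariety ℂ) [AlgebraicGeometry.IsIntegral A.X.left] (Θ : CartierDivisor A.X.left), Θ.IsAmple →
    ∀ (𝓔 : A.X.left.Modules), HasRank 𝓔 4 → 5 + 1 ≤ A.dim → EventuallyKoszul 𝓔 Θ

section JsonRay

variable {V W : Type*} [AddCommGroup V] [Module ℂ V] [AddCommGroup W] [Module ℂ W]

/-- **THE BLOCH RAY OF (design json, presentation)** — json ↦ the UNTWISTED design's Chern numbers `γ_k(D) ∈ ℚ` (v21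
`Design.chernCoeffₖ`), presentation ↦ four linear maps `f` (the transported untwisted cupped sigmas of §28.1): `Π_t = polyFamily 3
(blochCoeff f γ₁ γ₂ γ₃) t = f₃ + (γ₁+t)f₂ + (γ₂+γ₁t+t²)f₁ + (γ₃+γ₂t+γ₁t²+t³)f₀` (v22). A DEFINITION (pure algebra). -/
def Design.blochRay (D : Design) (f : Fin 4 → (V →ₗ[ℂ] W)) (t : ℂ) : V →ₗ[ℂ] W :=
  TwistRay.polyFamily 3
    (TwistRay.blochCoeff f ((D.chernCoeff₁ : ℚ) : ℂ) ((D.chernCoeff₂ : ℚ) : ℂ) ((D.chernCoeff₃ : ℚ) : ℂ)) t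

theorem Design.blochRay_apply (D : Design) (f : Fin 4 → (V →ₗ[ℂ] W)) (t : ℂ) (x : V) :
    D.blochRay f t x =
      f 3 x + (((D.chernCoeff₁ : ℚ) : ℂ) + t) • f 2 x +
        (((D.chernCoeff₂ : ℚ) : ℂ) + ((D.chernCoeff₁ : ℚ) : ℂ) * t + t ^ 2) • f 1 x +
          (((D.chernCoeff₃ : ℚ) : ℂ) + ((D.chernCoeff₂ : ℚ) : ℂ) * t + ((D.chernCoeff₁ : ℚ) : ℂ) * t ^ 2 + t ^ 3) • f 0 x :=
  TwistRay.polyFamily_blochCoeff_apply f _ _ _ t x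

/-- **THE `t`-FREE C7 CLAUSE ON (design json, presentation)**: the Bloch ray of `(D, f)` is injective at SOME parameter — v22's
`TwistRay.LciDoorGeneric f γ₁(D) γ₂(D) γ₃(D)`. Decided by ONE rank computation (`TwistRay.injective_polyFamily_iff_le_rank`). -/
def Design.LciGeneric (D : Design) (f : Fin 4 → (V →ₗ[ℂ] W)) : Prop :=
  TwistRay.LciDoorGeneric f ((D.chernCoeff₁ : ℚ) : ℂ) ((D.chernCoeff₂ : ℚ) : ℂ) ((D.chernCoeff₃ : ℚ) : ℂ)

theorem Design.lciGeneric_iff (D : Design) (f : Fin 4 → (V →ₗ[ℂ] W)) :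
    D.LciGeneric f ↔ ∃ t : ℂ, Function.Injective (D.blochRay f t) :=
  Iff.rfl

/-- ONE injective parameter (any complex `t₁`, e.g. a natural twist, or `t₁ = 0`: the untwisted `D_ξ c₄` polarised) certifies the clause. -/
theorem Design.lciGeneric_of_injective (D : Design) {f : Fin 4 → (V →ₗ[ℂ] W)} {t₁ : ℂ}
    (h : Function.Injective (D.blochRay f t₁)) : D.LciGeneric f :=
  ⟨t₁, h⟩

variable [FiniteDimensional ℂ V] [FiniteDimensional ℂ W]

/-- **ONE PARAMETER DECIDES, ON NATURAL TWISTS**: a cubic ray injective at one complex parameter is injective at every sufficiently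
large NATURAL twist (v22 `TwistRay.setOf_not_injective_finite` pulled back along `ℕ ↪ ℂ`; the shape v17's C7∞ quantifies over). -/
theorem eventually_injective_nat_of_injective_once (d : ℕ) (G : ℕ → (V →ₗ[ℂ] W)) {t₁ : ℂ}
    (h₁ : Function.Injective (TwistRay.polyFamily d G t₁)) :
    ∃ t₀ : ℕ, ∀ t : ℕ, t₀ ≤ t → Function.Injective (TwistRay.polyFamily d G (t : ℂ)) := by
  have hfin := TwistRay.setOf_not_injective_finite d G h₁
  have hfinN : {t : ℕ | ¬ Function.Injective (TwistRay.polyFamily d G (t : ℂ))}.Finite :=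
    (hfin.preimage Nat.cast_injective.injOn).subset fun t ht => ht
  obtain ⟨B, hB⟩ := hfinN.bddAbove
  refine ⟨B + 1, fun t ht => ?_⟩
  by_contra hbad
  have htB : t ≤ B := hB hbad
  omega

/-- the clause ⟹ the Bloch ray of `(D, f)` is injective at every sufficiently large natural twist. -/
theorem Design.LciGeneric.eventually_injective {D : Design} {f : Fin 4 → (V →ₗ[ℂ] W)} (h : D.LciGeneric f) :
    ∃ t₀ : ℕ, ∀ t : ℕ, t₀ ≤ t → Function.Injective (D.blochRay f (t : ℂ)) := by
  obtain ⟨t₁, h₁⟩ := h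
  exact eventually_injective_nat_of_injective_once 3 _ h₁

/-- **DEATH BY COUNTING ON NATURAL TWISTS** (v22's budget): if the Bloch ray of `(D, f)` fails to be injective at MORE THAN `3·dim V`
natural twists, it is injective at NO parameter — the clause is dead (and with it, under the law and the staircase, C7 at every twist
of the window carrying an admissible section). -/
theorem Design.blochRay_dead_of_nat_failures (D : Design) (f : Fin 4 → (V →ₗ[ℂ] W)) (T : Finset ℕ)
    (hcard : Module.finrank ℂ V * 3 < T.card) (hT : ∀ t ∈ T, ¬ Function.Injective (D.blochRay f (t : ℂ))) :
    ¬ D.LciGeneric f := by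
  rintro ⟨t₁, h₁⟩
  have hcard' : Module.finrank ℂ V * 3 < (T.map ⟨(Nat.cast : ℕ → ℂ), Nat.cast_injective⟩).card := by
    rwa [Finset.card_map]
  refine TwistRay.blochRay_dead_of_failures f _ _ _ (T.map ⟨(Nat.cast : ℕ → ℂ), Nat.cast_injective⟩) hcard' ?_ t₁ h₁
  intro t ht
  obtain ⟨n, hn, rfl⟩ := Finset.mem_map.1 ht
  exact hT n hn

end JsonRay

/-! ### §28.1 The (L5⁺)(3) staircase as DATA, and the dictionary as a THEOREM -/

namespace TwistTransport

section Staircase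

variable {X : Motives.SchemeOver ℂ} [AlgebraicGeometry.IsIntegral X.left]

/-- **THE TWIST STAIRCASE — DATA, CONSTRUCTED BY NO ONE IN THIS FILE.** For a bundle `𝓔`, a Cartier divisor `Θ`, a degree-`2` class
`h` (intended: `c₁(𝒪(Θ))`, on the anchor `h_std`) and a Hodge-to-Betti realisation `ρ`: (`e`) additive isomorphisms
`Ext²(𝓔(tΘ), 𝓔(tΘ)) ≃+ V` onto ONE `ℂ`-space (intended: `Ext²` is twist-invariant, `𝓔nd(𝓔(tΘ)) = 𝓔nd 𝓔`); (`ι`) an injective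
linear map `W ↪ H⁸(X(ℂ); ℂ)` (intended: `W = H^{3,5}`, or all of `H⁸`, or coordinates `ℂⁿ`); (`f`) four linear maps `V → W`
(intended: the UNTWISTED cupped sigmas `h^{3−i} ∪ ρ σ̃_i^{𝓔}`); and the four STAIRCASE ROWS — (L5⁺)(3) read in `H⁸` after cupping with
`h^{3−j}`: `h^{3−j} ∪ ρ σ̃_j^{𝓔(tΘ)} = Σ_{i ≤ j} C(j,i) (−t)^{j−i} · ι f_i` on transported vectors (from `At(𝓔(tΘ)) = At(𝓔) − t·h`,
the Atiyah class of a tensor product with a line bundle, and `h^{3−j} ∪ h^{j−i} = h^{3−i}`). The rows are stated for EVERY proof `hF`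
(proof-irrelevant) and every `t : ℕ`. A refuter reads them as the specification of the transport a presentation must deliver.
[cite: Huybrechts2005, Prop. 4.3.7 (ii) and Prop. 4.3.10] [cite: BuchweitzFlenner2003, Prop. 8.2] -/
structure Staircase (ρ : HodgeToBetti X) (𝓔 : X.left.Modules) (Θ : CartierDivisor X.left) (h : complexBetti X 2)
    (V W : Type*) [AddCommGroup V] [Module ℂ V] [AddCommGroup W] [Module ℂ W] where
  /-- transport of `Ext²(𝓔(tΘ), 𝓔(tΘ))` onto the fixed space `V` -/
  e : ∀ t : ℕ, Ext (twistBy 𝓔 Θ t) (twistBy 𝓔 Θ t) 2 ≃+ V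
  /-- the target injection `W ↪ H⁸(X(ℂ); ℂ)` -/
  ι : W →ₗ[ℂ] complexBetti X (2 * 4)
  ι_injective : Function.Injective ι
  /-- the four untwisted cupped sigmas, transported -/
  f : Fin 4 → (V →ₗ[ℂ] W)
  /-- row `j = 0`: `h³ ∪ ρ σ̃₀` is twist-invariant -/
  stair₀ : ∀ (t : ℕ) (hF : IsFiniteLocallyFree (twistBy 𝓔 Θ t)) (x : V),
    hCuppedSigma ρ hF h 0 ((e t).symm x) = ι (f 0 x)
  /-- row `j = 1`: `h² ∪ ρ σ̃₁^{𝓔(tΘ)} = f₁ − t f₀` -/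
  stair₁ : ∀ (t : ℕ) (hF : IsFiniteLocallyFree (twistBy 𝓔 Θ t)) (x : V),
    hCuppedSigma ρ hF h 1 ((e t).symm x) = ι (f 1 x) + (-(t : ℂ)) • ι (f 0 x)
  /-- row `j = 2`: `h ∪ ρ σ̃₂^{𝓔(tΘ)} = f₂ − 2t f₁ + t² f₀` -/
  stair₂ : ∀ (t : ℕ) (hF : IsFiniteLocallyFree (twistBy 𝓔 Θ t)) (x : V),
    hCuppedSigma ρ hF h 2 ((e t).symm x) = ι (f 2 x) + (2 * -(t : ℂ)) • ι (f 1 x) + (-(t : ℂ)) ^ 2 • ι (f 0 x)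
  /-- row `j = 3`: `ρ σ̃₃^{𝓔(tΘ)} = f₃ − 3t f₂ + 3t² f₁ − t³ f₀` -/
  stair₃ : ∀ (t : ℕ) (hF : IsFiniteLocallyFree (twistBy 𝓔 Θ t)) (x : V),
    hCuppedSigma ρ hF h 3 ((e t).symm x) =
      ι (f 3 x) + (3 * -(t : ℂ)) • ι (f 2 x) + (3 * (-(t : ℂ)) ^ 2) • ι (f 1 x) + (-(t : ℂ)) ^ 3 • ι (f 0 x)

variable {ρ : HodgeToBetti X} {𝓔 : X.left.Modules} {Θ : CartierDivisor X.left} {h : complexBetti X 2}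
  {V W : Type*} [AddCommGroup V] [Module ℂ V] [AddCommGroup W] [Module ℂ W]

/-- the rows at `t = 0` PIN the four maps: `ι ∘ f_j = (h^{3−j} ∪ ρ σ̃_j^{𝓔}) ∘ (e 0)⁻¹` — the only freedom in a staircase is the
transport (`e`, `ι`), which injectivity statements do not see. -/
theorem Staircase.ι_f_eq (S : Staircase ρ 𝓔 Θ h V W) (hF : IsFiniteLocallyFree (twistBy 𝓔 Θ 0)) (x : V) :
    S.ι (S.f 0 x) = hCuppedSigma ρ hF h 0 ((S.e 0).symm x) ∧ S.ι (S.f 1 x) = hCuppedSigma ρ hF h 1 ((S.e 0).symm x) ∧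
      S.ι (S.f 2 x) = hCuppedSigma ρ hF h 2 ((S.e 0).symm x) ∧ S.ι (S.f 3 x) = hCuppedSigma ρ hF h 3 ((S.e 0).symm x) := by
  refine ⟨(S.stair₀ 0 hF x).symm, ?_, ?_, ?_⟩
  · have e := S.stair₁ 0 hF x
    simp only [Nat.cast_zero, neg_zero, zero_smul, add_zero] at e
    exact e.symm
  · have e := S.stair₂ 0 hF x
    simp only [Nat.cast_zero, neg_zero, mul_zero, zero_smul, add_zero, ne_eq, OfNat.ofNat_ne_zero, not_false_eq_true,
      zero_pow] at e
    exact e.symm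
  · have e := S.stair₃ 0 hF x
    simp only [Nat.cast_zero, neg_zero, mul_zero, zero_smul, add_zero, ne_eq, OfNat.ofNat_ne_zero, not_false_eq_true,
      zero_pow] at e
    exact e.symm

/-- through a staircase, injectivity of ANY additive map on `Ext²(𝓔(tΘ), 𝓔(tΘ))` that factors as `ι ∘ g ∘ e t` is injectivity of `g`. -/
theorem Staircase.injective_iff_of_factor (S : Staircase ρ 𝓔 Θ h V W) {t : ℕ}
    {φ : Ext (twistBy 𝓔 Θ t) (twistBy 𝓔 Θ t) 2 →+ complexBetti X (2 * 4)} {g : V →ₗ[ℂ] W}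
    (hφ : ∀ y, φ y = S.ι (g (S.e t y))) : Function.Injective φ ↔ Function.Injective g := by
  constructor
  · intro hinj u v huv
    apply (S.e t).symm.injective
    apply hinj
    rw [hφ, hφ, AddEquiv.apply_symm_apply, AddEquiv.apply_symm_apply, huv]
  · intro hinj y z hyz
    rw [hφ, hφ] at hyz
    exact (S.e t).injective (hinj (S.ι_injective hyz))

end Staircase

section Anchor

variable {E₀ : AbelianVariety ℂ} {ψ₀ : E₀ ⟶ E₀} {C : ChernCharacterBetti} [AlgebraicGeometry.IsIntegral (pad4Anchor E₀).X.left]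
  {ρ : HodgeToBetti (pad4Anchor E₀).X} {𝓔 : (pad4Anchor E₀).X.left.Modules} {Θ : CartierDivisor (pad4Anchor E₀).X.left}
  {F : WeilFrame E₀ ψ₀} {h : complexBetti (pad4Anchor E₀).X 2} {D : Design}
  {V W : Type*} [AddCommGroup V] [Module ℂ V] [AddCommGroup W] [Module ℂ W]

/-- **THE DICTIONARY AS A THEOREM — json half + object half.** For a design passing C0 (so `rank = D.coeff 0 = 4`, `D` clean) whose
twists `D(t)` are realised by `𝓔(tΘ)` for every `t` (v4 `Design.RealisedBy`, the dictionary clause of v17's checker), and a staircase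
`S`: **the adjugate Atiyah trace of `𝓔(tΘ)`, transported, IS the Bloch ray of the UNTWISTED design at the parameter `t`** —
`blochAdjugate C ρ hF ((S.e t)⁻¹ x) = S.ι (D.blochRay S.f t x)`. Proof: v21 `blochAdjugate_eq_pencil_of_realisedBy` (the trace is the
pencil of the TWISTED cupped sigmas with coefficients `γ_k(D(t))` at twist `0`), v21 `Design.chernCoeff_tw` (`γ_k(D(t))` = the Chern
numbers of a twist), the four rows, and the recombination `Σ_j γ_{3−j}(D(t)) C(j,i) (−t)^{j−i} = v_{3−i}(t)` (`module`). -/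
theorem Staircase.blochAdjugate_symm_apply (S : Staircase ρ 𝓔 Θ h V W) (hC0 : D.ClassData)
    (hR : ∀ t : ℕ, (D.tw t).RealisedBy C F h (twistBy 𝓔 Θ t)) (t : ℕ) (hF : IsFiniteLocallyFree (twistBy 𝓔 Θ t)) (x : V) :
    blochAdjugate C ρ hF ((S.e t).symm x) = S.ι (D.blochRay S.f (t : ℂ) x) := by
  have hD : D.Clean := hC0.1
  have h0 : D.coeff 0 = 4 := Design.coeff_zero_of_classData hC0
  obtain ⟨e1, e2, e3⟩ := Design.chernCoeff_tw hD h0 (t : ℤ)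
  have c1 : (((D.tw (t : ℤ)).chernCoeff₁ : ℚ) : ℂ) = ((D.chernCoeff₁ : ℚ) : ℂ) + 4 * (t : ℂ) := by
    rw [e1]; push_cast; ring
  have c2 : (((D.tw (t : ℤ)).chernCoeff₂ : ℚ) : ℂ) =
      ((D.chernCoeff₂ : ℚ) : ℂ) + 3 * ((D.chernCoeff₁ : ℚ) : ℂ) * (t : ℂ) + 6 * (t : ℂ) ^ 2 := by
    rw [e2]; push_cast; ring
  have c3 : (((D.tw (t : ℤ)).chernCoeff₃ : ℚ) : ℂ) =
      ((D.chernCoeff₃ : ℚ) : ℂ) + 2 * ((D.chernCoeff₂ : ℚ) : ℂ) * (t : ℂ) + 3 * ((D.chernCoeff₁ : ℚ) : ℂ) * (t : ℂ) ^ 2 +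
        4 * (t : ℂ) ^ 3 := by
    rw [e3]; push_cast; ring
  rw [blochAdjugate_eq_pencil_of_realisedBy ρ hF (hR t), BlochPencil.pencil_apply, S.stair₀ t hF x, S.stair₁ t hF x,
    S.stair₂ t hF x, S.stair₃ t hF x, Design.blochRay_apply, map_add, map_add, map_add, map_smul, map_smul, map_smul, c1, c2, c3]
  module

/-- the same, untransported: `blochAdjugate C ρ hF y = S.ι (D.blochRay S.f t (S.e t y))`. -/
theorem Staircase.blochAdjugate_apply (S : Staircase ρ 𝓔 Θ h V W) (hC0 : D.ClassData)
    (hR : ∀ t : ℕ, (D.tw t).RealisedBy C F h (twistBy 𝓔 Θ t)) (t : ℕ) (hF : IsFiniteLocallyFree (twistBy 𝓔 Θ t))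
    (y : Ext (twistBy 𝓔 Θ t) (twistBy 𝓔 Θ t) 2) :
    blochAdjugate C ρ hF y = S.ι (D.blochRay S.f (t : ℂ) (S.e t y)) := by
  have e := S.blochAdjugate_symm_apply hC0 hR t hF (S.e t y)
  rwa [AddEquiv.symm_apply_apply] at e

/-- **C7'S MAP IS THE RAY**: injectivity of the adjugate trace of `𝓔(tΘ)` ⟺ injectivity of the Bloch ray of `(D, f)` at `t` —
ONE rank computation (in coordinates, v22 `TwistRay.injective_polyFamily_iff_le_rank`). -/
theorem Staircase.injective_blochAdjugate_iff (S : Staircase ρ 𝓔 Θ h V W) (hC0 : D.ClassData)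
    (hR : ∀ t : ℕ, (D.tw t).RealisedBy C F h (twistBy 𝓔 Θ t)) (t : ℕ) (hF : IsFiniteLocallyFree (twistBy 𝓔 Θ t)) :
    Function.Injective (blochAdjugate C ρ hF) ↔ Function.Injective (D.blochRay S.f (t : ℂ)) :=
  S.injective_iff_of_factor (S.blochAdjugate_apply hC0 hR t hF)

/-- **v22's `hdict` AS A THEOREM** (under v21's law, at every twist of the Koszul window that carries an admissible section):
`C7 at t ⟺ Injective (D.blochRay S.f t)` — the abstract dictionary of `SeedCheckerTwistRay` §22.3 instantiated, so all of v22's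
checker-shaped consequences (cofinitely many good twists, `≤ 3·dim V` bad ones, the `9409`-failure death) now hold for the REAL C7. -/
theorem Staircase.hdict (S : Staircase ρ 𝓔 Θ h V W) (hlaw : BlochAdjugateLaw C (pad4Anchor E₀).X ρ) (hrk : HasRank 𝓔 4)
    (hC0 : D.ClassData) (hR : ∀ t : ℕ, (D.tw t).RealisedBy C F h (twistBy 𝓔 Θ t)) {t : ℕ}
    (hK : KoszulWindowAcyclic (twistBy 𝓔 Θ t))
    (hex : ∃ (s : Modules.unitModule (pad4Anchor E₀).X.left ⟶ twistBy 𝓔 Θ t) (Z : Scheme.{0})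
      (i : Z ⟶ (pad4Anchor E₀).X.left), IsZeroSchemeOf s i ∧ IsRegularImmersionOfCodim i 4) :
    SemiregularZeroLociAt 𝓔 Θ t ↔ Function.Injective (D.blochRay S.f (t : ℂ)) :=
  (semiregularZeroLociAt_iff_injective hlaw hrk hK hex).trans
    (S.injective_blochAdjugate_iff hC0 hR t (isFiniteLocallyFree_twistBy hrk Θ t))

/-- the `←` half needs no section: an injective ray at a twist of the window makes EVERY admissible zero scheme at that twist
Bloch-semiregular. -/
theorem Staircase.semiregularZeroLociAt_of_injective_blochRay (S : Staircase ρ 𝓔 Θ h V W)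
    (hlaw : BlochAdjugateLaw C (pad4Anchor E₀).X ρ) (hrk : HasRank 𝓔 4) (hC0 : D.ClassData)
    (hR : ∀ t : ℕ, (D.tw t).RealisedBy C F h (twistBy 𝓔 Θ t)) {t : ℕ} (hK : KoszulWindowAcyclic (twistBy 𝓔 Θ t))
    (hinj : Function.Injective (D.blochRay S.f (t : ℂ))) : SemiregularZeroLociAt 𝓔 Θ t :=
  semiregularZeroLociAt_of_injective hlaw hrk hK
    ((S.injective_blochAdjugate_iff hC0 hR t (isFiniteLocallyFree_twistBy hrk Θ t)).2 hinj)

/-- (with (L-Bert), the existential is automatic at high twist: the dictionary holds EVENTUALLY with no section hypothesis.) -/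
theorem Staircase.eventually_hdict (S : Staircase ρ 𝓔 Θ h V W) (hbert : HighTwistBertini) (hΘ : Θ.IsAmple)
    (hlaw : BlochAdjugateLaw C (pad4Anchor E₀).X ρ) (hrk : HasRank 𝓔 4) (hKz : EventuallyKoszul 𝓔 Θ) (hC0 : D.ClassData)
    (hR : ∀ t : ℕ, (D.tw t).RealisedBy C F h (twistBy 𝓔 Θ t)) :
    ∃ t₀ : ℕ, ∀ t : ℕ, t₀ ≤ t → (SemiregularZeroLociAt 𝓔 Θ t ↔ Function.Injective (D.blochRay S.f (t : ℂ))) := by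
  obtain ⟨tK, hK⟩ := hKz
  obtain ⟨tB, hB⟩ := hbert (pad4Anchor E₀) Θ hΘ 𝓔 4 hrk
  refine ⟨max tK tB, fun t ht => S.hdict hlaw hrk hC0 hR (hK t (le_of_max_le_left ht)) ?_⟩
  obtain ⟨s, Z, i, hZ, hreg, -, -⟩ := hB t (le_of_max_le_right ht)
  exact ⟨s, Z, i, hZ, hreg⟩

/-- … and the NECESSITY of the clause at high twist, given (L-Bert): C7∞ ⟹ the ray is injective at some (indeed every large) natural
twist ⟹ `D.LciGeneric S.f`. So under the laws and a staircase, C7∞ ⟺ the `t`-free clause. -/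
theorem Staircase.lciGeneric_of_eventuallySemiregularZeroLoci (S : Staircase ρ 𝓔 Θ h V W) (hbert : HighTwistBertini)
    (hΘ : Θ.IsAmple) (hlaw : BlochAdjugateLaw C (pad4Anchor E₀).X ρ) (hrk : HasRank 𝓔 4) (hKz : EventuallyKoszul 𝓔 Θ)
    (hC0 : D.ClassData) (hR : ∀ t : ℕ, (D.tw t).RealisedBy C F h (twistBy 𝓔 Θ t)) (h7 : EventuallySemiregularZeroLoci 𝓔 Θ) :
    D.LciGeneric S.f := by
  obtain ⟨t₀, hd⟩ := S.eventually_hdict hbert hΘ hlaw hrk hKz hC0 hR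
  obtain ⟨t₇, h₇⟩ := h7
  exact ⟨((max t₀ t₇ : ℕ) : ℂ), (hd _ (le_max_left _ _)).1 (h₇ _ (le_max_right _ _))⟩

variable [FiniteDimensional ℂ V] [FiniteDimensional ℂ W]

/-- **THE EVENTUAL FORM: v17's C7∞ FROM ONE RANK COMPUTATION** — GIVEN v21's law: rank `4`, the Koszul clause, C0, the dictionary
clause at every twist, a staircase, and the `t`-free clause `D.LciGeneric S.f` (ONE injective parameter) ⟹ `EventuallySemiregularZeroLoci
𝓔 Θ`. (`max` of the Koszul threshold and v22's finiteness threshold on natural twists.) -/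
theorem Staircase.eventuallySemiregularZeroLoci_of_lciGeneric (S : Staircase ρ 𝓔 Θ h V W)
    (hlaw : BlochAdjugateLaw C (pad4Anchor E₀).X ρ) (hrk : HasRank 𝓔 4) (hKz : EventuallyKoszul 𝓔 Θ) (hC0 : D.ClassData)
    (hR : ∀ t : ℕ, (D.tw t).RealisedBy C F h (twistBy 𝓔 Θ t)) (hgen : D.LciGeneric S.f) :
    EventuallySemiregularZeroLoci 𝓔 Θ := by
  obtain ⟨tK, hK⟩ := hKz
  obtain ⟨tI, hI⟩ := hgen.eventually_injective
  exact ⟨max tK tI, fun t ht =>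
    S.semiregularZeroLociAt_of_injective_blochRay hlaw hrk hC0 hR (hK t (le_of_max_le_left ht))
      (hI t (le_of_max_le_right ht))⟩

theorem Staircase.eventuallySemiregularZeroLoci_iff_lciGeneric (S : Staircase ρ 𝓔 Θ h V W) (hbert : HighTwistBertini)
    (hΘ : Θ.IsAmple) (hlaw : BlochAdjugateLaw C (pad4Anchor E₀).X ρ) (hrk : HasRank 𝓔 4) (hKz : EventuallyKoszul 𝓔 Θ)
    (hC0 : D.ClassData) (hR : ∀ t : ℕ, (D.tw t).RealisedBy C F h (twistBy 𝓔 Θ t)) :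
    EventuallySemiregularZeroLoci 𝓔 Θ ↔ D.LciGeneric S.f :=
  ⟨S.lciGeneric_of_eventuallySemiregularZeroLoci hbert hΘ hlaw hrk hKz hC0 hR,
    S.eventuallySemiregularZeroLoci_of_lciGeneric hlaw hrk hKz hC0 hR⟩

end Anchor

end TwistTransport

/-! ### §28.2 The one-rank checker on (design json, presentation) and its doors to the crux -/

section OneRank

variable {E₀ : AbelianVariety ℂ} {ψ₀ : E₀ ⟶ E₀} {C : ChernCharacterBetti}

/-- **THE ONE-RANK CHECKER — a predicate on (design json `D`, presentation = a rank-`4` bundle `𝓔` on the anchor, an ample Cartier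
divisor `Θ` with `𝓔(tΘ)` realising `D(t)` for every `t`, and a twist staircase `S` against `h_std`)**: C0; `Θ` ample; rank `4`; the
dictionary clause (v17); the Koszul clause; and **C7 as the `t`-free clause `D.LciGeneric S.f`** — the Bloch ray of the UNTWISTED
design's Chern numbers and the four transported cupped sigmas is injective at ONE parameter. v17's `Design.HighTwistCheck` with its
one conjectural clause C7∞ replaced by a rank computation (given `BlochAdjugateLaw`: `Design.highTwistCheck_of_oneRankCheck`). NO C5,
NO C6, NO (σ) — not checks in this regime (v17 flags). -/
def Design.OneRankCheck [AlgebraicGeometry.IsIntegral (pad4Anchor E₀).X.left] (D : Design) (C : ChernCharacterBetti)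
    (K : AnchorKit E₀ ψ₀) (𝓔 : (pad4Anchor E₀).X.left.Modules) (Θ : CartierDivisor (pad4Anchor E₀).X.left)
    {ρ : HodgeToBetti (pad4Anchor E₀).X} {V W : Type*} [AddCommGroup V] [Module ℂ V] [AddCommGroup W] [Module ℂ W]
    (S : TwistTransport.Staircase ρ 𝓔 Θ (hStd E₀ K.η) V W) : Prop :=
  D.ClassData ∧ Θ.IsAmple ∧ HasRank 𝓔 4 ∧ (∀ t : ℕ, (D.tw t).RealisedBy C K.F (hStd E₀ K.η) (twistBy 𝓔 Θ t)) ∧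
    EventuallyKoszul 𝓔 Θ ∧ D.LciGeneric S.f

variable [AlgebraicGeometry.IsIntegral (pad4Anchor E₀).X.left] {D : Design} {K : AnchorKit E₀ ψ₀}
  {𝓔 : (pad4Anchor E₀).X.left.Modules} {Θ : CartierDivisor (pad4Anchor E₀).X.left} {ρ : HodgeToBetti (pad4Anchor E₀).X}
  {V W : Type*} [AddCommGroup V] [Module ℂ V] [AddCommGroup W] [Module ℂ W] [FiniteDimensional ℂ V] [FiniteDimensional ℂ W]
  {S : TwistTransport.Staircase ρ 𝓔 Θ (hStd E₀ K.η) V W}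

/-- **one-rank check ⟹ v17's high-twist check**, given v21's law. -/
theorem Design.highTwistCheck_of_oneRankCheck (hlaw : BlochAdjugateLaw C (pad4Anchor E₀).X ρ)
    (h : D.OneRankCheck C K 𝓔 Θ S) : D.HighTwistCheck C K 𝓔 Θ := by
  obtain ⟨hC0, hΘ, hrk, hR, hKz, hgen⟩ := h
  exact ⟨hC0, hΘ, hrk, hR, S.eventuallySemiregularZeroLoci_of_lciGeneric hlaw hrk hKz hC0 hR hgen⟩

omit [FiniteDimensional ℂ V] [FiniteDimensional ℂ W] in
/-- conversely (given (L-Bert) too) a high-twist pair with the Koszul clause and a staircase passes the one-rank check: the two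
checkers are EQUIVALENT predicates on such data. -/
theorem Design.oneRankCheck_of_highTwistCheck (hbert : HighTwistBertini) (hlaw : BlochAdjugateLaw C (pad4Anchor E₀).X ρ)
    (hKz : EventuallyKoszul 𝓔 Θ) (h : D.HighTwistCheck C K 𝓔 Θ) : D.OneRankCheck C K 𝓔 Θ S := by
  obtain ⟨hC0, hΘ, hrk, hR, h7⟩ := h
  exact ⟨hC0, hΘ, hrk, hR, hKz, S.lciGeneric_of_eventuallySemiregularZeroLoci hbert hΘ hlaw hrk hKz hC0 hR h7⟩

/-- the Koszul clause from the law (L-Serre) on the anchor (`dim S⁴ = 8 ≥ 6`). -/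
theorem eventuallyKoszul_of_highTwistKoszul (hser : HighTwistKoszul) (hE : E₀.dim = 1) (hΘ : Θ.IsAmple) (hrk : HasRank 𝓔 4) :
    EventuallyKoszul 𝓔 Θ :=
  hser (pad4Anchor E₀) Θ hΘ 𝓔 hrk (by rw [pad4Anchor_dim hE]; norm_num)

/-- **THE LCI DOOR FROM THE ONE-RANK CHECKER, GIVEN THE LAWS** ((L-conn), (L-Bert), `TopChernFourLocalisation`, `BlochAdjugateLaw`;
(L-int) is v18's theorem): a passing pair gives, at SOME twist and for the zero scheme of SOME section, a passing lci-door pair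
`D.SeedCheck K i q` (C0 ∧ C5 ∧ C6 ∧ C7 ∧ (σ)). -/
theorem Design.seedCheck_of_oneRankCheck (hE : E₀.dim = 1) (hψ : ψ₀ ≫ ψ₀ = -(1 • 𝟙 E₀)) (hconn : HighTwistConnectedness)
    (hbert : HighTwistBertini) (hloc : TopChernFourLocalisation C) (hlaw : BlochAdjugateLaw C (pad4Anchor E₀).X ρ)
    (h : D.OneRankCheck C K 𝓔 Θ S) :
    ∃ (t : ℕ) (s : Modules.unitModule (pad4Anchor E₀).X.left ⟶ twistBy 𝓔 Θ t) (Z : Scheme.{0})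
      (i : Z ⟶ (pad4Anchor E₀).X.left) (q : ℚ), IsZeroSchemeOf s i ∧ D.SeedCheck K i q :=
  D.seedCheck_of_highTwist hE hψ K hconn hbert smoothConnectedIntegral_holds hloc (D.highTwistCheck_of_oneRankCheck hlaw h)

/-- … hence the conclusion of `stub_rung_pad4_seedAt` ON THAT ANCHOR, given the laws (v17 `seedData_of_highTwist`). -/
theorem seedData_of_oneRankCheck (hE : E₀.dim = 1) (hψ : ψ₀ ≫ ψ₀ = -(1 • 𝟙 E₀)) (hconn : HighTwistConnectedness)
    (hbert : HighTwistBertini) (hloc : TopChernFourLocalisation C) (hlaw : BlochAdjugateLaw C (pad4Anchor E₀).X ρ)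
    (h : D.OneRankCheck C K 𝓔 Θ S) :
    ∃ (e : ProjectiveEmbedding (pad4Anchor E₀).X) (a : complexBetti (projectiveSpace e.n ℂ) 2)
      (w : complexBetti (pad4Anchor E₀).X (2 * 4)),
      IsRationalClass a ∧ a ≠ 0 ∧
      IsHyperbolicWeilType (pad4Anchor E₀) (pad4Action E₀ ψ₀) 4 (symH (pad4Action E₀ ψ₀) e a) ∧
      w ∈ weilClassesOf (pad4Anchor E₀) (pad4Action E₀ ψ₀) 4 1 ∧ IsRationalClass w ∧ w ≠ 0 ∧
      HasBlochSeedAt 4 (pad4Anchor E₀) (symH (pad4Action E₀ ψ₀) e a) w :=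
  seedData_of_highTwist hE hψ K hconn hbert smoothConnectedIntegral_holds hloc (D.highTwistCheck_of_oneRankCheck hlaw h)

end OneRank

/-- **PASSING ONE-RANK PAIRS ON EVERY CM ANCHOR ⟹ THE CRUX `BlochSeedDiscOne` BY NAME, GIVEN THE LAWS** — hypothesis-carrying, not
`exact?`-abusable: three global laws and, per anchor, a Hodge-to-Betti realisation with v21's law, a design, a kit, a bundle, an ample
divisor and a twist staircase in COORDINATES (`V = ℂ^m`, `W = ℂ^n`, so the C7 clause is `m ≤ rank` of one explicit `n × m` matrix at one
parameter) passing `OneRankCheck` — data no one has constructed. Through v17 `blochSeedDiscOne_of_highTwistChecks` with (L-int) :=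
v18 `smoothConnectedIntegral_holds`. NOTHING toward HC ∕ HC_CM ∕ HC_AV ∕ 18881 is proved by this theorem. -/
theorem blochSeedDiscOne_of_oneRankChecks {C : ChernCharacterBetti} (hconn : HighTwistConnectedness) (hbert : HighTwistBertini)
    (hloc : TopChernFourLocalisation C)
    (h : ∀ (E₀ : AbelianVariety ℂ) (ψ₀ : E₀ ⟶ E₀), E₀.dim = 1 → ψ₀ ≫ ψ₀ = -(1 • 𝟙 E₀) →
      haveI := pad4Anchor_isIntegral E₀
      ∃ (ρ : HodgeToBetti (pad4Anchor E₀).X) (_ : BlochAdjugateLaw C (pad4Anchor E₀).X ρ) (D : Design) (K : AnchorKit E₀ ψ₀)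
        (𝓔 : (pad4Anchor E₀).X.left.Modules) (Θ : CartierDivisor (pad4Anchor E₀).X.left) (m n : ℕ)
        (S : TwistTransport.Staircase ρ 𝓔 Θ (hStd E₀ K.η) (Fin m → ℂ) (Fin n → ℂ)), D.OneRankCheck C K 𝓔 Θ S) :
    Summit.HodgeConjecture.HodgeConjecture.Theses.EightfoldBlochSeeds.BlochSeedDiscOne :=
  blochSeedDiscOne_of_highTwistChecks hconn hbert smoothConnectedIntegral_holds hloc fun E₀ ψ₀ hE hψ => by
    haveI := pad4Anchor_isIntegral E₀
    obtain ⟨ρ, hlaw, D, K, 𝓔, Θ, m, n, S, hD⟩ := h E₀ ψ₀ hE hψ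
    exact ⟨D, K, 𝓔, Θ, D.highTwistCheck_of_oneRankCheck hlaw hD⟩

/-- (in coordinates `V = ℂ^m`, `W = ℂ^n` the C7 clause of `OneRankCheck` is literally: ONE `n × m` matrix with CUBIC polynomial entries
— v22's `TwistRay.polyMatrix` of the Bloch ray of `(D, f)` — has rank `≥ m` at SOME parameter; v22 `injective_polyFamily_iff_le_rank`.) -/
theorem Design.lciGeneric_iff_exists_rank {m n : ℕ} (D : Design) (f : Fin 4 → ((Fin m → ℂ) →ₗ[ℂ] (Fin n → ℂ))) :
    D.LciGeneric f ↔ ∃ t : ℂ, m ≤ ((TwistRay.polyMatrix 3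
      (TwistRay.blochCoeff f ((D.chernCoeff₁ : ℚ) : ℂ) ((D.chernCoeff₂ : ℚ) : ℂ) ((D.chernCoeff₃ : ℚ) : ℂ))).map
        (Polynomial.eval t)).rank := by
  simp only [Design.lciGeneric_iff, Design.blochRay, TwistRay.injective_polyFamily_iff_le_rank, Module.finrank_fin_fun]

end VTwentyEight

/-! ## Audit (v28): nothing is decided here

Defs: `SemiregularZeroLociAt`, `EventuallyKoszul` (predicates on the tree's real carriers), `HighTwistKoszul` (a `Prop` — (L-Serre), a
NAMED LAW consumed only as a hypothesis, never asserted), `Design.blochRay`, `Design.LciGeneric` (pure algebra on the json numbers and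
four abstract maps), `TwistTransport.Staircase` (a structure = DATA, constructed by no one: the (L5⁺)(3) transport rows a presentation
must deliver), `Design.OneRankCheck` (a predicate on (design, presentation, staircase)). Every `theorem` is proved: linear algebra
(`module`), v21's json identities, v22's finiteness, repackaging through v17 ∕ v18 ∕ v21. `Design.seedCheck_of_oneRankCheck`,
`seedData_of_oneRankCheck`, `blochSeedDiscOne_of_oneRankChecks` carry (L-conn), (L-Bert), `TopChernFourLocalisation`,
`BlochAdjugateLaw` AND, per anchor, a realisation, a design, a kit, a bundle, an ample divisor and a staircase passing the check among
their hypotheses. No `sorry`, no new axiom, no `instance`, no `notation`, no `macro`. HC ∕ HC_CM ∕ HC_AV ∕ №4 ∕ 26512 ∕ 18881 ∕ H2 ∕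
`BlochSeedDiscOne` ∕ `stub_rung_pad4_seedAt` are NOT proved here; this is a typed file, not a rung. -/
theorem audit_v28_nothing_asserted : True := trivial

end Summit.HodgeConjecture.HodgeConjecture.Cruxes.BlochSeedDiscOne.SeedChecker

end
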